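import Literature.Barriers.AtomisticToContinuum.HardDiskDeformationTransfer
import Literature.Barriers.AtomisticToContinuum.HardDiskDeformationMeasurable
import Literature.Barriers.AtomisticToContinuum.HardDiskGibbsMeasurability
import HarnessLib

/-!
# Lemma 8 of Richthammer 2007 in coordinates: the deformation of a source cell preserves the
# hard core ((5.5)), and keeps the particles in the box

Sequel to `HardDiskDeformationTransfer.lean` (provefact `Richthammer2007_ineq35`; the hard-core
and stay-in-`Λ` parts of the transfer fields of `ShearCells.Admissible`). Richthammer's (5.5):
"`x₁, x₂ ∈ X`, `x₁ - x₂ ∉ K ⇒ (x₁ + t_{n,X}(x₁)e₁) - (x₂ + t_{n,X}(x₂)e₁) ∉ K`" [Richthammer2007,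
§5.4 Lemma 8], proved in §6.3 from (6.4) — on `(pⁱ + K) ∩ Lⁱ`, `Lⁱ := {t^i ≥ τ^i}`, all later
translation functions equal `τ^i` — and (6.5) `T^j(Lⁱ ∖ (pⁱ + K)) = Lⁱ ∖ (pⁱ + K) + τ^i e₁`, which
rests on "`T^j(·, r)` is increasing, continuous and bijective" and `t^j = τ^i` on `∂Lⁱ(·, r)`.
Here `K` is the closed Euclidean unit disc. Proved, for tuples of a source cell `A_π`, both
directions `σ = ±1`, parameters `ε > 0`, `0 ≤ τ ≤ 1/2`, `R + 1 ≤ n`: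

* `image_subset_of_fixes_frontier` — a strictly increasing self-map of `ℝ` fixing the frontier
  of a closed set maps the set into itself (the order-theoretic core of (6.5));
* `coe_stageFun_add`, `mAux_eq_of_norm_le_one`, `stageFun_eq_tau_of_core` ((6.4)),
  `stageFun_eq_tau_of_eq` (later functions equal `τ_s` where `t^{s+1} = τ_s`);
* `dist_shearMap_gt_one` — (5.5) for two particles; `dist_shearMap_outside_gt_one` — (5.5) for a
  particle and an unmoved point of the boundary condition outside `Λ_n` (`m_{x,0}` vanishes on
  `x + K`, so the deformation is the identity there);
* `shearMap_apply_mem_box` — particles of `Λ_n` stay in `Λ_n` (`0 ≤ t ≤ t⁰ = τ_n(|·|)`,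
  `τ_n = 0` outside `Λ_n`; part of (5.7)/(6.10));
* **`hardCoreIn_superpose_shearMap`** — the hard core in `Λ_n` passes from `X_x X̄` to the
  deformed configuration.

## References

* [Richthammer2007] T. Richthammer, *Translation-invariance of two-dimensional Gibbsian point
  processes*, Comm. Math. Phys. 274 (2007) 81–122, arXiv:0706.3637: §5.4 Lemma 8 (5.4)–(5.5),
  Lemma 9 (5.7) (p. 11), §6.3 (6.3)–(6.5) (pp. 13–14), §6.4 (6.10)–(6.11) (p. 14).
-/

noncomputable section

open MeasureTheory Set Function Filter
open scoped ENNReal NNReal Topology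

namespace Literature.Barriers.AtomisticToContinuum.HardDisk

open Literature.Analysis.FunctionSpaces Literature.MeasureTheory.Lebesgue

/-! ### Order-theoretic core of (6.5) -/

/-- Between a point of a set and a point outside it there is a frontier point. [folklore] -/
theorem exists_mem_frontier_mem_uIcc {L : Set ℝ} {u v : ℝ} (hu : u ∈ L) (hv : v ∉ L) :
    ∃ c ∈ frontier L, c ∈ uIcc u v := by
  by_contra h
  push Not at h
  have hc : IsPreconnected (uIcc u v) := isPreconnected_uIcc
  -- `uIcc u v` is covered by the open sets `interior L` and `(closure L)ᶜ`
  have hcov : uIcc u v ⊆ interior L ∪ (closure L)ᶜ := by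
    intro x hx
    by_contra hx'
    simp only [mem_union, mem_compl_iff, not_or, not_not] at hx'
    exact h x ⟨hx'.2, hx'.1⟩ hx
  have h1 : (uIcc u v ∩ interior L).Nonempty := by
    refine ⟨u, left_mem_uIcc, ?_⟩
    rcases hcov left_mem_uIcc with h' | h'
    · exact h'
    · exact absurd (subset_closure hu) h'
  have h2 : (uIcc u v ∩ (closure L)ᶜ).Nonempty := by
    refine ⟨v, right_mem_uIcc, ?_⟩
    rcases hcov right_mem_uIcc with h' | h'
    · exact absurd (interior_subset h') hv
    · exact h'
  obtain ⟨x, -, hx1, hx2⟩ := hc _ _ isOpen_interior isClosed_closure.isOpen_compl hcov h1 h2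
  exact hx2 (interior_subset_closure hx1)

/-- **A strictly increasing self-map of the line fixing the frontier of a closed set maps the set
into itself** (the order-theoretic core of (6.5): "`T^j(·,r)` is increasing, continuous and
bijective, so `T^j(Lⁱ) = Lⁱ + τⁱ e₁`"). [cite: Richthammer2007, §6.3 (6.5) (p. 14)] -/
theorem image_subset_of_fixes_frontier {S : ℝ → ℝ} (hS : StrictMono S) {L : Set ℝ}
    (hL : IsClosed L) (hfix : ∀ c ∈ frontier L, S c = c) : S '' L ⊆ L := by
  rintro _ ⟨r, hr, rfl⟩
  by_contra hSr
  obtain ⟨c, hc, hcI⟩ := exists_mem_frontier_mem_uIcc hr hSr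
  have hcL : c ∈ L := hL.frontier_subset hc
  have hSc := hfix c hc
  rcases lt_or_gt_of_ne (show r ≠ S r from fun h => hSr (h ▸ hr)) with hlt | hgt
  · -- `r < S r`, `c ∈ [r, S r]`, `S c = c ≥ S r` forces `c = S r ∈ L`
    rw [uIcc_of_le hlt.le] at hcI
    have h1 : S r ≤ S c := hS.monotone hcI.1
    rw [hSc] at h1
    have : c = S r := le_antisymm hcI.2 h1
    exact hSr (this ▸ hcL)
  · rw [uIcc_of_ge hgt.le] at hcI
    have h1 : S c ≤ S r := hS.monotone hcI.2
    rw [hSc] at h1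
    have : c = S r := le_antisymm h1 hcI.1
    exact hSr (this ▸ hcL)

/-- Scaling by `|σ| ≤ 1` and shifting preserve a Lipschitz constant. [folklore] -/
theorem lipschitzWith_const_mul_sub_const {L : ℝ≥0} {g : ℝ → ℝ} (hg : LipschitzWith L g)
    {σ : ℝ} (hσ : |σ| ≤ 1) (c : ℝ) : LipschitzWith L fun r => σ * (g r - c) := by
  refine LipschitzWith.of_dist_le_mul fun a b => ?_
  have h := hg.dist_le_mul a b
  rw [Real.dist_eq, Real.dist_eq] at h ⊢
  rw [show σ * (g a - c) - σ * (g b - c) = σ * (g a - g b) by ring, abs_mul]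
  calc |σ| * |g a - g b| ≤ 1 * |g a - g b| := mul_le_mul_of_nonneg_right hσ (abs_nonneg _)
    _ = |g a - g b| := one_mul _
    _ ≤ L * |a - b| := h

namespace DeformData

variable {P : DeformData}

/-! ### (6.4): later translation functions are constant `τ_s` near `p_s` and on `∂L_s` -/

variable (P) in
/-- The constraints of a concatenation. [folklore] -/
theorem listShift_append (E F : List (EuclideanSpace ℝ (Fin 2) × ℝ)) (y : EuclideanSpace ℝ (Fin 2)) :
    P.listShift (E ++ F) y = P.listShift E y ⊓ P.listShift F y := by
  induction E with
  | nil => simp [listShift]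
  | cons a l ih =>
    simp only [listShift, List.cons_append, List.map_cons, List.foldr_cons] at ih ⊢
    rw [ih, inf_assoc]

/-- **The stage functions factor**: `↑t^{s+d+1}(y) = ↑t^{s+1}(y) ⊓ ⋀_{s ≤ i < s+d} m_{p_i,τ_i}(y)`.
[cite: Richthammer2007, §5.4 (p. 11, `t^k = t⁰ ∧ ⋀_{i<k} m_{pⁱ,τⁱ}`)] -/
theorem coe_stageFun_add (hτ : 0 ≤ P.τ) (hRn : P.R < P.n) (Y : PointConfig (EuclideanSpace ℝ (Fin 2)))
    {k : ℕ} (π : Equiv.Perm (Fin k)) (x : Fin k → EuclideanSpace ℝ (Fin 2)) (s d : ℕ)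
    (y : EuclideanSpace ℝ (Fin 2)) :
    (P.stageFun Y π x (s + d) y : EReal) = (P.stageFun Y π x s y : EReal) ⊓
      P.listShift ((List.range d).map fun i =>
        (posSeq π x (s + i), P.stageTau Y (posSeq π x) (s + i))) y := by
  have hsplit : P.stagePairs Y (posSeq π x) (s + d) = P.stagePairs Y (posSeq π x) s ++
      (List.range d).map fun i => (posSeq π x (s + i), P.stageTau Y (posSeq π x) (s + i)) := by
    rw [stagePairs_eq_map_range, stagePairs_eq_map_range, List.range_add, List.map_append,
      List.map_map]
    rfl
  have hE : ∀ pt ∈ P.stagePairs Y (posSeq π x) s, 0 ≤ pt.2 := stagePairs_nonneg hτ hRn Y _ _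
  have hEF : ∀ pt ∈ P.stagePairs Y (posSeq π x) (s + d), 0 ≤ pt.2 := stagePairs_nonneg hτ hRn Y _ _
  unfold stageFun
  rw [coe_stageShift hτ hRn Y hEF, coe_stageShift hτ hRn Y hE, hsplit, listShift_append]
  simp only [inf_assoc]

/-- `m_{x',t} = t` on the closed unit disc around `x'` (`f_K = 0` on `K`).
[cite: Richthammer2007, §6.3 (p. 13, "`m_{pⁱ,τⁱ}(x) = τⁱ` by `x ∈ pⁱ + K`")] -/
theorem mAux_eq_of_norm_le_one (hε : 0 < P.ε) (x' : EuclideanSpace ℝ (Fin 2)) (t : ℝ)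
    {y : EuclideanSpace ℝ (Fin 2)} (hy : ‖y - x'‖ ≤ 1) : P.mAux x' t y = (t : EReal) := by
  have h0 : fK P.ε (y - x') = 0 := fK_eq_zero hε hy
  unfold mAux
  split_ifs with h1 h2
  · rfl
  · rw [h0] at h2; exact absurd h2 zero_ne_one
  · rw [h0, mul_zero, add_zero]

/-- `τ_s = t^{s+1}(p_s)` in terms of `stageTau`. [folklore] -/
theorem stageTau_posSeq {k : ℕ} (Y : PointConfig (EuclideanSpace ℝ (Fin 2))) (π : Equiv.Perm (Fin k))
    (x : Fin k → EuclideanSpace ℝ (Fin 2)) (s : ℕ) :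
    P.stageTau Y (posSeq π x) s = P.stageFun Y π x s (posSeq π x s) := rfl

/-- The position of stage `s < k` is `x (π (rev s))`. [folklore] -/
theorem posSeq_of_lt {k : ℕ} (π : Equiv.Perm (Fin k)) (x : Fin k → EuclideanSpace ℝ (Fin 2)) {s : ℕ}
    (hs : s < k) : posSeq π x s = x (π (Fin.rev ⟨s, hs⟩)) := by
  simp [posSeq, dif_pos hs]

/-- On the source cell, the constraints added at the stages `b, …, b+d-1 < k` after stage
`s ≤ b` are all `≥ τ_s` (`m_{p_i,τ_i} ≥ τ_i ≥ τ_s`, (5.3'')). [cite: Richthammer2007, §6.3 (p. 13)] -/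
theorem tau_le_listShift_range (hτ : 0 ≤ P.τ) (hRn : P.R < P.n) (Y : PointConfig (EuclideanSpace ℝ (Fin 2)))
    {k : ℕ} {π : Equiv.Perm (Fin k)} {x : Fin k → EuclideanSpace ℝ (Fin 2)}
    (hx : x ∈ P.sourceCell Y k π) {s : ℕ} (hs : s < k) {b : ℕ} (hsb : s ≤ b) (d : ℕ) (hbd : b + d ≤ k)
    (y : EuclideanSpace ℝ (Fin 2)) :
    (P.stageFun Y π x s (x (π (Fin.rev ⟨s, hs⟩))) : EReal) ≤
      P.listShift ((List.range d).map fun i =>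
        (posSeq π x (b + i), P.stageTau Y (posSeq π x) (b + i))) y := by
  induction d with
  | zero => simp [listShift]
  | succ d ih =>
    rw [List.range_succ, List.map_append, List.map_singleton, listShift_append]
    refine le_inf (ih (by omega)) ?_
    simp only [listShift, List.map_cons, List.map_nil, List.foldr_cons, List.foldr_nil, inf_top_eq]
    have hbd' : b + d < k := by omega
    refine le_trans ?_ (P.le_mAux _ _ y)
    rw [EReal.coe_le_coe_iff, stageTau_posSeq, posSeq_of_lt π x hbd']
    exact tau_monotone hτ hRn Y hx (by omega) hbd'

/-- **Later translation functions are `τ_s` wherever `t^{s+1} = τ_s`** (on the source cell, for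
stages `s ≤ s'' ≤ k`: the added constraints `m_{p_i,τ_i} ≥ τ_i ≥ τ_s`).
[cite: Richthammer2007, §6.3 (6.4) (pp. 13–14)] -/
theorem stageFun_eq_tau_of_eq (hτ : 0 ≤ P.τ) (hRn : P.R < P.n) (Y : PointConfig (EuclideanSpace ℝ (Fin 2)))
    {k : ℕ} {π : Equiv.Perm (Fin k)} {x : Fin k → EuclideanSpace ℝ (Fin 2)}
    (hx : x ∈ P.sourceCell Y k π) {s : ℕ} (hs : s < k) {s'' : ℕ} (hss : s ≤ s'') (hs''k : s'' ≤ k)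
    {y : EuclideanSpace ℝ (Fin 2)}
    (hy : P.stageFun Y π x s y = P.stageFun Y π x s (x (π (Fin.rev ⟨s, hs⟩)))) :
    P.stageFun Y π x s'' y = P.stageFun Y π x s (x (π (Fin.rev ⟨s, hs⟩))) := by
  obtain ⟨d, rfl⟩ := Nat.exists_eq_add_of_le hss
  have h := coe_stageFun_add hτ hRn Y π x s d y
  rw [hy] at h
  have hge := tau_le_listShift_range hτ hRn Y hx hs le_rfl d hs''k y
  have : (P.stageFun Y π x (s + d) y : EReal) = (P.stageFun Y π x s (x (π (Fin.rev ⟨s, hs⟩))) : EReal) := by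
    rw [h]; exact inf_eq_left.2 hge
  exact_mod_cast this

/-- **(6.4): on `L_s ∩ (p_s + K)` all later translation functions equal `τ_s`** (source cell,
`s < s'' ≤ k`, `K` the closed unit disc, `L_s = {t^{s+1} ≥ τ_s}`).
[cite: Richthammer2007, §6.3 (6.4) (pp. 13–14)] -/
theorem stageFun_eq_tau_of_core (hε : 0 < P.ε) (hτ : 0 ≤ P.τ) (hRn : P.R < P.n)
    (Y : PointConfig (EuclideanSpace ℝ (Fin 2)))
    {k : ℕ} {π : Equiv.Perm (Fin k)} {x : Fin k → EuclideanSpace ℝ (Fin 2)}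
    (hx : x ∈ P.sourceCell Y k π) {s : ℕ} (hs : s < k) {s'' : ℕ} (hss : s < s'') (hs''k : s'' ≤ k)
    {y : EuclideanSpace ℝ (Fin 2)}
    (hyL : P.stageFun Y π x s (x (π (Fin.rev ⟨s, hs⟩))) ≤ P.stageFun Y π x s y)
    (hyK : ‖y - x (π (Fin.rev ⟨s, hs⟩))‖ ≤ 1) :
    P.stageFun Y π x s'' y = P.stageFun Y π x s (x (π (Fin.rev ⟨s, hs⟩))) := by
  -- `t^{s+2}(y) = t^{s+1}(y) ∧ m_{p_s,τ_s}(y) = τ_s`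
  have h1 : P.stageFun Y π x (s + 1) y = P.stageFun Y π x s (x (π (Fin.rev ⟨s, hs⟩))) := by
    have h := coe_stageFun_add hτ hRn Y π x s 1 y
    simp only [List.range_one, List.map_cons, List.map_nil, add_zero, listShift, List.foldr_cons,
      List.foldr_nil, inf_top_eq, stageTau_posSeq, posSeq_of_lt π x hs] at h
    rw [mAux_eq_of_norm_le_one hε _ _ hyK] at h
    have : (P.stageFun Y π x (s + 1) y : EReal) =
        (P.stageFun Y π x s (x (π (Fin.rev ⟨s, hs⟩))) : EReal) := by
      rw [h]; exact inf_eq_right.2 (EReal.coe_le_coe_iff.2 hyL)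
    exact_mod_cast this
  -- the later constraints are `≥ τ_s`
  obtain ⟨d, rfl⟩ := Nat.exists_eq_add_of_lt hss
  have h := coe_stageFun_add hτ hRn Y π x (s + 1) d y
  rw [h1] at h
  have hge := tau_le_listShift_range hτ hRn Y hx hs (Nat.le_succ s) d (by omega) y
  have : (P.stageFun Y π x (s + 1 + d) y : EReal) =
      (P.stageFun Y π x s (x (π (Fin.rev ⟨s, hs⟩))) : EReal) := by
    rw [h]; exact inf_eq_left.2 hge
  rw [show s + d + 1 = s + 1 + d by ring]
  exact_mod_cast this

/-! ### (5.5) for two particles -/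

/-- **(5.5) for two particles of a source cell**: particles at Euclidean distance `> 1` stay at
distance `> 1` under the deformation in direction `σ e₁` (`|σ| ≤ 1`). Proof as in §6.3: for the
earlier particle `p_s` (stage `s`) and the later `y = x_l` (stage `s'' > s`) one has `y ∈ L_s`;
on the line through `y` the map `r ↦ r + σ (t^{s''+1} - τ_s)` is strictly increasing and fixes
the frontier of the closed set `L_s` (where `t^{s''+1} = τ_s`), so `w := z_l - σ τ_s e₁ ∈ L_s`;
if `|z_l - z_{l'}| = |w - p_s| ≤ 1` then `t^{s''+1}(w) = τ_s` ((6.4)), so `w` and `y` have the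
same image under the injective shear of the line, `w = y`, contradicting `|y - p_s| > 1`.
[cite: Richthammer2007, §5.4 Lemma 8 (5.5) (p. 11), proof §6.3 (6.4)–(6.5) (pp. 13–14)] -/
theorem dist_shearMap_gt_one (hε : 0 < P.ε) (hτ : 0 ≤ P.τ) (hτ2 : P.τ ≤ 1 / 2) (hRn : P.R + 1 ≤ P.n)
    {σ : ℝ} (hσ : |σ| ≤ 1) (Y : PointConfig (EuclideanSpace ℝ (Fin 2)))
    {k : ℕ} {π : Equiv.Perm (Fin k)} {x : Fin k → EuclideanSpace ℝ (Fin 2)}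
    (hx : x ∈ P.sourceCell Y k π) {l l' : Fin k} (hll : l ≠ l') (hd : 1 < dist (x l) (x l')) :
    1 < dist (shearMap (fun j y => σ * P.richtShift Y k π j y) x l)
      (shearMap (fun j y => σ * P.richtShift Y k π j y) x l') := by
  have hRn0 : P.R < P.n := Nat.lt_of_succ_le hRn
  have hhalf : (1 / 2 : ℝ≥0) < 1 := by norm_num
  have hlip : ∀ s p, LipschitzWith (1 / 2 : ℝ≥0) fun r : ℝ =>
      P.stageFun Y π x s (p + r • EuclideanSpace.single 0 (1 : ℝ)) :=
    fun s p => lipschitz_stageShift_line hε hτ hτ2 hRn Y (stagePairs_nonneg hτ hRn0 Y _ _) p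
  -- order the two particles by stage: `l'` earlier (stage `s`), `l` later (stage `s''`)
  wlog hstage : stageOf π l' < stageOf π l generalizing l l'
  · have hne : stageOf π l ≠ stageOf π l' := fun h => hll (by
      rw [eq_rev_stageOf π l, eq_rev_stageOf π l']; simp only [h])
    have h' := this hll.symm (by rwa [dist_comm]) (lt_of_le_of_ne (not_lt.1 hstage) hne)
    rwa [dist_comm]
  set s := stageOf π l' with hs
  set s'' := stageOf π l with hs''
  have hsk : s < k := stageOf_lt π l'
  have hs''k : s'' < k := stageOf_lt π l
  have hl' : l' = π (Fin.rev ⟨s, hsk⟩) := eq_rev_stageOf π l'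
  -- notation
  set ps := x l' with hps
  set τs := P.stageFun Y π x s ps with hτs
  set g := P.stageFun Y π x s'' with hg
  set y := x l with hy
  have hzl' : shearMap (fun j y => σ * P.richtShift Y k π j y) x l' =
      ps + (σ * τs) • EuclideanSpace.single 0 (1 : ℝ) := by
    rw [shearMap_smul_richtShift_apply, richtShift_eq_stageFun]
  have hzl : shearMap (fun j y => σ * P.richtShift Y k π j y) x l =
      y + (σ * g y) • EuclideanSpace.single 0 (1 : ℝ) := by
    rw [shearMap_smul_richtShift_apply, richtShift_eq_stageFun]
  rw [hzl', hzl]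
  -- `y ∈ L_s`: `τ_s ≤ t^{s+1}(y)` (argmin at stage `s`, `l` remaining)
  have hyL : τs ≤ P.stageFun Y π x s y := by
    have hmem : l ∈ remaining π s := hstage.le
    have h := (hx.2 ⟨s, hsk⟩).le hmem
    rw [← hl'] at h
    exact h
  -- the line through `y`: `L := {r | τ_s ≤ t^{s+1}(y + r e₁)}` is closed and `S := r ↦ r + σ(g - τ_s)`
  -- is strictly increasing and fixes its frontier
  set Lline : Set ℝ := {r | τs ≤ P.stageFun Y π x s (y + r • EuclideanSpace.single 0 (1 : ℝ))} with hL
  have hcont : Continuous fun r : ℝ => P.stageFun Y π x s (y + r • EuclideanSpace.single 0 (1 : ℝ)) :=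
    (hlip s y).continuous
  have hLclosed : IsClosed Lline := isClosed_le continuous_const hcont
  set S : ℝ → ℝ := fun r => r + σ * (g (y + r • EuclideanSpace.single 0 (1 : ℝ)) - τs) with hSdef
  have hSlip : LipschitzWith (1 / 2 : ℝ≥0) fun r : ℝ => σ * (g (y + r • EuclideanSpace.single 0 (1 : ℝ)) - τs) :=
    lipschitzWith_const_mul_sub_const (hlip s'' y) hσ τs
  have hSmono : StrictMono S := strictMono_id_add hSlip hhalf
  have hfix : ∀ c ∈ frontier Lline, S c = c := by
    intro c hc
    have hsub := frontier_le_subset_eq continuous_const hcont hc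
    simp only [mem_setOf_eq] at hsub
    -- `t^{s+1} = τ_s` there, hence `g = τ_s`
    have hgc : g (y + c • EuclideanSpace.single 0 (1 : ℝ)) = τs := by
      rw [hg, hτs, hps, hl']
      refine stageFun_eq_tau_of_eq hτ hRn0 Y hx hsk hstage.le hs''k.le ?_
      rw [← hl', ← hps, ← hτs]; exact hsub.symm
    simp only [hSdef, hgc, sub_self, mul_zero, add_zero]
  -- `0 ∈ L`, hence `S 0 ∈ L`: `w := y + S(0) e₁ = z_l - σ τ_s e₁ ∈ L_s`
  have h0 : (0 : ℝ) ∈ Lline := by simp only [hL, mem_setOf_eq, zero_smul, add_zero]; exact hyL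
  have hS0 : S 0 ∈ Lline := image_subset_of_fixes_frontier hSmono hLclosed hfix ⟨0, h0, rfl⟩
  have hS0val : S 0 = σ * (g y - τs) := by simp only [hSdef, zero_smul, add_zero, zero_add]
  set w := y + (σ * (g y - τs)) • EuclideanSpace.single 0 (1 : ℝ) with hw
  have hwL : τs ≤ P.stageFun Y π x s w := by
    have := hS0; rw [hS0val] at this; exact this
  -- suppose the images are at distance `≤ 1`
  by_contra hclose
  push Not at hclose
  have hdiff : y + (σ * g y) • EuclideanSpace.single 0 (1 : ℝ) - (ps + (σ * τs) • EuclideanSpace.single 0 1) =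
      w - ps := by
    rw [hw, mul_sub, sub_smul]; abel
  rw [dist_eq_norm, hdiff] at hclose
  -- then `g w = τ_s` by (6.4)
  have hgw : g w = τs := by
    rw [hg, hτs, hps, hl']
    refine stageFun_eq_tau_of_core hε hτ hRn0 Y hx hsk hstage hs''k.le ?_ ?_
    · rw [← hl', ← hps, ← hτs]; exact hwL
    · rw [← hl', ← hps]; exact hclose
  -- so `w` and `y` have the same image under the (injective) shear of the line through `y`
  have hinj : StrictMono fun r : ℝ => r + σ * g (y + r • EuclideanSpace.single 0 (1 : ℝ)) := by
    have hl0 : LipschitzWith (1 / 2 : ℝ≥0) fun r : ℝ => σ * g (y + r • EuclideanSpace.single 0 (1 : ℝ)) := by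
      have := lipschitzWith_const_mul_sub_const (hlip s'' y) hσ 0
      simp only [sub_zero] at this
      exact this
    exact strictMono_id_add hl0 hhalf
  have himg : (σ * (g y - τs)) + σ * g w = 0 + σ * g y := by
    rw [hgw]; ring
  have hw' : w = y + (σ * (g y - τs)) • EuclideanSpace.single 0 (1 : ℝ) := hw
  have key : σ * (g y - τs) = 0 := by
    have h1 : (fun r : ℝ => r + σ * g (y + r • EuclideanSpace.single 0 (1 : ℝ))) (σ * (g y - τs)) =
        (fun r : ℝ => r + σ * g (y + r • EuclideanSpace.single 0 (1 : ℝ))) 0 := by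
      beta_reduce
      rw [← hw', zero_smul, add_zero]
      exact himg
    exact hinj.injective h1
  have hwy : w = y := by rw [hw, key, zero_smul, add_zero]
  rw [hwy] at hclose
  rw [dist_eq_norm] at hd
  exact absurd hd (not_lt.2 hclose)

/-! ### (5.5) for a particle and an unmoved outside point -/

/-- The constraints of the boundary condition bound the stage functions:
`↑t^{s+1}(y) ≤ m_{q,0}(y)` for every `q ∈ X̄` outside `Λ_n`. [cite: Richthammer2007, §5.4 (p. 11)] -/
theorem coe_stageFun_le_mAux (hτ : 0 ≤ P.τ) (hRn : P.R < P.n) {Y : PointConfig (EuclideanSpace ℝ (Fin 2))}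
    {k : ℕ} (π : Equiv.Perm (Fin k)) (x : Fin k → EuclideanSpace ℝ (Fin 2)) (s : ℕ)
    {q : EuclideanSpace ℝ (Fin 2)} (hq : q ∈ Y) (hqn : q ∉ box (P.n : ℝ)) (y : EuclideanSpace ℝ (Fin 2)) :
    (P.stageFun Y π x s y : EReal) ≤ P.mAux q 0 y := by
  unfold stageFun
  rw [coe_stageShift hτ hRn Y (stagePairs_nonneg hτ hRn Y _ _)]
  refine inf_le_left.trans (inf_le_right.trans ?_)
  exact iInf_le (fun q' : {q' : EuclideanSpace ℝ (Fin 2) // q' ∈ Y ∧ q' ∉ box (P.n : ℝ)} =>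
    P.mAux q'.1 0 y) ⟨q, hq, hqn⟩

/-- **The deformation vanishes on `q + K` for every `q ∈ X̄` outside `Λ_n`** (`m_{q,0} = 0`
there). [cite: Richthammer2007, §5.4 (5.6) (p. 11) and §6.3 (p. 13)] -/
theorem stageFun_eq_zero_of_norm_sub_le (hε : 0 < P.ε) (hτ : 0 ≤ P.τ) (hRn : P.R < P.n)
    {Y : PointConfig (EuclideanSpace ℝ (Fin 2))} {k : ℕ} (π : Equiv.Perm (Fin k))
    (x : Fin k → EuclideanSpace ℝ (Fin 2)) (s : ℕ) {q : EuclideanSpace ℝ (Fin 2)} (hq : q ∈ Y)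
    (hqn : q ∉ box (P.n : ℝ)) {y : EuclideanSpace ℝ (Fin 2)} (hy : ‖y - q‖ ≤ 1) :
    P.stageFun Y π x s y = 0 := by
  have h := coe_stageFun_le_mAux hτ hRn π x s hq hqn y
  rw [mAux_eq_of_norm_le_one hε q 0 hy] at h
  have h0 : P.stageFun Y π x s y ≤ 0 := by exact_mod_cast h
  exact le_antisymm h0 (stageShift_mem_Icc hτ hRn Y (stagePairs_nonneg hτ hRn Y _ _) y).1

/-- **(5.5) for a particle and a point of the boundary condition outside `Λ_n`** (which the
deformation does not move): distance `> 1` is preserved, for every tuple. If the moved particle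
`z = y + σ t(y) e₁` were within distance `1` of `q`, then `t(z) = 0`, so `z` and `y` would have
the same image under the injective shear of the line through `y`, forcing `z = y`.
[cite: Richthammer2007, §5.4 Lemma 8 (5.5) (p. 11), §6.3 (pp. 13–14)] -/
theorem dist_shearMap_outside_gt_one (hε : 0 < P.ε) (hτ : 0 ≤ P.τ) (hτ2 : P.τ ≤ 1 / 2)
    (hRn : P.R + 1 ≤ P.n) {σ : ℝ} (hσ : |σ| ≤ 1) {Y : PointConfig (EuclideanSpace ℝ (Fin 2))}
    {k : ℕ} (π : Equiv.Perm (Fin k)) (x : Fin k → EuclideanSpace ℝ (Fin 2)) (l : Fin k)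
    {q : EuclideanSpace ℝ (Fin 2)} (hq : q ∈ Y) (hqn : q ∉ box (P.n : ℝ)) (hd : 1 < dist (x l) q) :
    1 < dist (shearMap (fun j y => σ * P.richtShift Y k π j y) x l) q := by
  have hRn0 : P.R < P.n := Nat.lt_of_succ_le hRn
  have hhalf : (1 / 2 : ℝ≥0) < 1 := by norm_num
  set s := stageOf π l with hs
  set g := P.stageFun Y π x s with hg
  set y := x l with hy
  have hlip : ∀ p, LipschitzWith (1 / 2 : ℝ≥0) fun r : ℝ =>
      g (p + r • EuclideanSpace.single 0 (1 : ℝ)) :=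
    fun p => lipschitz_stageShift_line hε hτ hτ2 hRn Y (stagePairs_nonneg hτ hRn0 Y _ _) p
  have hzl : shearMap (fun j y => σ * P.richtShift Y k π j y) x l =
      y + (σ * g y) • EuclideanSpace.single 0 (1 : ℝ) := by
    rw [shearMap_smul_richtShift_apply, richtShift_eq_stageFun]
  rw [hzl]
  by_contra hclose
  push Not at hclose
  rw [dist_eq_norm] at hclose
  have hgz : g (y + (σ * g y) • EuclideanSpace.single 0 (1 : ℝ)) = 0 :=
    stageFun_eq_zero_of_norm_sub_le hε hτ hRn0 π x s hq hqn hclose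
  have hinj : StrictMono fun r : ℝ => r + σ * g (y + r • EuclideanSpace.single 0 (1 : ℝ)) := by
    have hl0 : LipschitzWith (1 / 2 : ℝ≥0) fun r : ℝ => σ * g (y + r • EuclideanSpace.single 0 (1 : ℝ)) := by
      have := lipschitzWith_const_mul_sub_const (hlip y) hσ 0
      simp only [sub_zero] at this
      exact this
    exact strictMono_id_add hl0 hhalf
  have key : σ * g y = 0 := by
    have h1 : (fun r : ℝ => r + σ * g (y + r • EuclideanSpace.single 0 (1 : ℝ))) (σ * g y) =
        (fun r : ℝ => r + σ * g (y + r • EuclideanSpace.single 0 (1 : ℝ))) 0 := by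
      beta_reduce
      rw [hgz, zero_smul, add_zero, mul_zero, add_zero, zero_add]
    exact hinj.injective h1
  rw [key, zero_smul, add_zero, ← dist_eq_norm] at hclose
  exact absurd hd (not_lt.2 hclose)

/-! ### Particles stay in the box -/

/-- Coordinates of a point moved along `e₁`. [folklore] -/
theorem add_smul_single_apply_zero (y : EuclideanSpace ℝ (Fin 2)) (c : ℝ) :
    (show EuclideanSpace ℝ (Fin 2) from y + c • EuclideanSpace.single 0 (1 : ℝ)) 0 = y 0 + c := by
  simp

/-- Coordinates of a point moved along `e₁`. [folklore] -/
theorem add_smul_single_apply_one (y : EuclideanSpace ℝ (Fin 2)) (c : ℝ) :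
    (show EuclideanSpace ℝ (Fin 2) from y + c • EuclideanSpace.single 0 (1 : ℝ)) 1 = y 1 := by
  simp

/-- **The basic translation distance is at most half the sup-distance to the boundary of `Λ_n`**:
`t⁰(y) = τ_n(|y|) ≤ τ (n - |y|) ≤ (n - |y|)/2` for `y ∈ Λ_n` (`τ_n` is `τ`-Lipschitz with
`τ_n(n) = 0`, `τ ≤ 1/2`). [cite: Richthammer2007, §5.3 (p. 11), §6.8 (6.15) (p. 17)] -/
theorem baseShift_le_half_dist (hτ : 0 ≤ P.τ) (hτ2 : P.τ ≤ 1 / 2) (hRn : P.R + 1 ≤ P.n)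
    {y : EuclideanSpace ℝ (Fin 2)} (hy : y ∈ box (P.n : ℝ)) :
    P.baseShift y ≤ (P.n - supNorm y) / 2 := by
  have hn0 : (0 : ℝ) ≤ P.n := Nat.cast_nonneg _
  have hsup : supNorm y ≤ P.n := supNorm_le_of_mem_box hn0 hy
  have hprofn : P.prof P.n = 0 := tProfile_eq_zero_of_le le_rfl
  have h := abs_prof_sub_prof_le hτ hRn (supNorm y) P.n
  rw [hprofn, sub_zero, abs_of_nonneg (prof_mem_Icc hτ (Nat.lt_of_succ_le hRn) _).1] at h
  rw [abs_of_nonpos (sub_nonpos.2 hsup)] at h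
  unfold baseShift
  have hns : 0 ≤ (P.n : ℝ) - supNorm y := sub_nonneg.2 hsup
  calc P.prof (supNorm y) ≤ P.τ * -(supNorm y - P.n) := h
    _ = P.τ * (P.n - supNorm y) := by ring
    _ ≤ 1 / 2 * (P.n - supNorm y) := mul_le_mul_of_nonneg_right hτ2 hns
    _ = (P.n - supNorm y) / 2 := by ring

/-- **Particles of `Λ_n` stay in `Λ_n`** under a move by `σ t e₁` with `|σ| ≤ 1` and
`0 ≤ t ≤ t⁰(y)` (in particular under `T_n` and `T̄_n`, whose translations are bounded by `t⁰`).
[cite: Richthammer2007, §5.4 Lemma 9 (5.7) (p. 11), §6.4 (6.10) (p. 14)] -/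
theorem add_smul_mem_box (hτ : 0 ≤ P.τ) (hτ2 : P.τ ≤ 1 / 2) (hRn : P.R + 1 ≤ P.n)
    {σ : ℝ} (hσ : |σ| ≤ 1) {y : EuclideanSpace ℝ (Fin 2)} (hy : y ∈ box (P.n : ℝ))
    {t : ℝ} (ht0 : 0 ≤ t) (ht : t ≤ P.baseShift y) :
    y + (σ * t) • EuclideanSpace.single 0 (1 : ℝ) ∈ box (P.n : ℝ) := by
  have hb := baseShift_le_half_dist hτ hτ2 hRn hy
  have ha : |y 0| ≤ supNorm y := abs_apply_le_supNorm y 0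
  have hst : |σ * t| ≤ t := by
    rw [abs_mul, abs_of_nonneg ht0]
    calc |σ| * t ≤ 1 * t := mul_le_mul_of_nonneg_right hσ ht0
      _ = t := one_mul t
  have hy0 := hy 0
  have hy1 := hy 1
  intro i
  fin_cases i
  · show -(P.n : ℝ) ≤ (show EuclideanSpace ℝ (Fin 2) from y + (σ * t) • EuclideanSpace.single 0 (1 : ℝ)) 0 ∧
      (show EuclideanSpace ℝ (Fin 2) from y + (σ * t) • EuclideanSpace.single 0 (1 : ℝ)) 0 < P.n
    rw [add_smul_single_apply_zero]
    have h1 : t ≤ ((P.n : ℝ) - |y 0|) / 2 := by linarith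
    have hσt1 : -(t) ≤ σ * t := (abs_le.1 hst).1
    have hσt2 : σ * t ≤ t := (abs_le.1 hst).2
    constructor
    · rcases le_or_gt 0 (y 0) with h0 | h0
      · rw [abs_of_nonneg h0] at h1; linarith
      · rw [abs_of_neg h0] at h1; linarith
    · rcases le_or_gt 0 (y 0) with h0 | h0
      · rw [abs_of_nonneg h0] at h1; linarith
      · rw [abs_of_neg h0] at h1; linarith
  · show -(P.n : ℝ) ≤ (show EuclideanSpace ℝ (Fin 2) from y + (σ * t) • EuclideanSpace.single 0 (1 : ℝ)) 1 ∧
      (show EuclideanSpace ℝ (Fin 2) from y + (σ * t) • EuclideanSpace.single 0 (1 : ℝ)) 1 < P.n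
    rw [add_smul_single_apply_one]
    exact hy1

/-- **The deformed particles stay in `Λ_n`** (`0 ≤ t_l ≤ t⁰(x_l)`).
[cite: Richthammer2007, §5.4 Lemma 9 (5.7) (p. 11), §6.4 (6.10) (p. 14)] -/
theorem shearMap_apply_mem_box (hτ : 0 ≤ P.τ) (hτ2 : P.τ ≤ 1 / 2) (hRn : P.R + 1 ≤ P.n)
    {σ : ℝ} (hσ : |σ| ≤ 1) (Y : PointConfig (EuclideanSpace ℝ (Fin 2))) {k : ℕ} (π : Equiv.Perm (Fin k))
    {x : Fin k → EuclideanSpace ℝ (Fin 2)} {l : Fin k} (hl : x l ∈ box (P.n : ℝ)) :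
    shearMap (fun j y => σ * P.richtShift Y k π j y) x l ∈ box (P.n : ℝ) := by
  have hRn0 : P.R < P.n := Nat.lt_of_succ_le hRn
  rw [shearMap_smul_richtShift_apply]
  have hI := stageShift_mem_Icc hτ hRn0 Y (stagePairs_nonneg hτ hRn0 Y (posSeq π x) (stageOf π l)) (x l)
  exact add_smul_mem_box hτ hτ2 hRn hσ hl hI.1 hI.2

/-! ### The hard core is preserved -/

/-- **Lemma 8 (5.5) ⇒ the hard core in `Λ_n` is preserved**: for a tuple `x` of the source cell
`A_π` with all particles in `Λ_n` and `X_x X̄` hard-core in `Λ_n`, the deformed configuration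
(direction `σ e₁`, `|σ| ≤ 1`) is hard-core in `Λ_n`.
[cite: Richthammer2007, §5.4 Lemma 8 (p. 11), §5.4 p. 12 ("By (5.5) … `T_n(X) ∈ A′`")] -/
theorem hardCoreIn_superpose_shearMap (hε : 0 < P.ε) (hτ : 0 ≤ P.τ) (hτ2 : P.τ ≤ 1 / 2)
    (hRn : P.R + 1 ≤ P.n) {σ : ℝ} (hσ : |σ| ≤ 1) {Y : PointConfig (EuclideanSpace ℝ (Fin 2))}
    {k : ℕ} {π : Equiv.Perm (Fin k)} {x : Fin k → EuclideanSpace ℝ (Fin 2)}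
    (hx : x ∈ P.sourceCell Y k π) (hxΛ : ∀ j, x j ∈ box (P.n : ℝ))
    (hHC : HardCoreIn (box (P.n : ℝ)) (superpose (box (P.n : ℝ)) x Y)) :
    HardCoreIn (box (P.n : ℝ)) (superpose (box (P.n : ℝ))
      (shearMap (fun j y => σ * P.richtShift Y k π j y) x) Y) := by
  rw [hardCoreIn_superpose_iff] at hHC ⊢
  refine ⟨fun i j _ _ hij => ?_, fun i _ q hq hqΛ => ?_⟩
  · have hij' : i ≠ j := fun h => hij (by rw [h])
    have hxij : x i ≠ x j := fun h => hij' (hx.1 h)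
    exact dist_shearMap_gt_one hε hτ hτ2 hRn hσ Y hx hij' (hHC.1 i j (hxΛ i) (hxΛ j) hxij)
  · exact dist_shearMap_outside_gt_one hε hτ hτ2 hRn hσ π x i hq hqΛ (hHC.2 i (hxΛ i) q hq hqΛ)

end DeformData

end Literature.Barriers.AtomisticToContinuum.HardDisk

end
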